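import Mathlib.Analysis.SpecialFunctions.Trigonometric.Bounds
import Mathlib.Topology.MetricSpace.ProperSpace
import Mathlib.Topology.Order.IntermediateValue
import Mathlib.Algebra.Order.BigOperators.Group.Finset
import Mathlib.Algebra.BigOperators.Field
import HarnessLib

/-!
# Colding's frame extension, synthetic form (Colding 1996a, §2)

The metric-space core of one step of the Gromov–Hausdorff assembly in Colding's volume sphere
theorem (`Colding1996_volume_ghClose`), isolated from all Riemannian geometry. In a compact
(pseudo)metric space `(M, d)` with `d ≤ π`, write `u_p = cos d(p, ·)`. Suppose finitely many
points `x_i` satisfy the frame relations `|u_{x_i}(x_{i'})| ≤ α`, have almost antipodes `x̄_i`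
(`sup |u_{x_i} + u_{x̄_i}| ≤ η`), and near every pair `(y₁, y₂)` there is a continuous path `γ`
from an `r`-perturbation `z₁` of `y₁` to an `r`-perturbation `z₂` of `y₂` along which every
`u_{x_i}` obeys the spherical interpolation law up to `β`
(`|sin ℓ u(γ s) − sin((1−s)ℓ) u(z₁) − sin(sℓ) u(z₂)| ≤ β`, `ℓ = d(z₁, z₂)`, `s ∈ [0,1]`) — the
conclusion of Colding's Lemma 2.10 (`ColdingCommonGoodGeodesics.lean`) read through the length
metric. Then, if `F = Σ_i u_{x_i}²` takes a value `≤ 1 − γ₁` somewhere, its minimum is `≤ γ`,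
provided `α, β, r, η` are explicitly small (`exists_sum_cos_dist_sq_le`): at a minimiser `z*`
with `F(z*) > γ`, let `u_{x_i}(z*)² = a` be the largest term; along the good path from (a
perturbation of) `x_i` or `x̄_i` (whichever has `cos d(·, z*) = −|u_{x_i}(z*)|`) to `z*` the
function `u_{x_i}` changes sign, so vanishes at some `q` (IVT), while the other `u_{x_{i'}}` are
divided by `sin ℓ ≥ √(1 − a) − ψ`; hence `F(q) ≤ (F − a)/(1 − a) + ψ < F(z*)`, a contradiction.
("Project away the largest component and renormalise.")

Everything here is proved; no definitions, no named facts (D-0026).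

## References

* T. H. Colding, *Shape of manifolds with positive Ricci curvature*, Invent. Math. 124 (1996)
  175–191, §2. [Colding1996Shape]
-/

noncomputable section

open Set Filter
open scoped BigOperators Topology

namespace Literature.Geometry.Riemannian

namespace ColdingSynthetic

variable {M : Type*} [PseudoMetricSpace M]

/-- `cos d(p, ·)` is `1`-Lipschitz: `|cos d(p, a) − cos d(p, b)| ≤ d(a, b)`. [folklore] -/
theorem abs_cos_dist_sub_cos_dist_le (p a b : M) :
    |Real.cos (dist p a) - Real.cos (dist p b)| ≤ dist a b := by
  refine (Real.abs_cos_sub_cos_le _ _).trans ?_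
  have h1 := abs_dist_sub_le a b p
  rwa [dist_comm a p, dist_comm b p] at h1

/-- `|d(z₁, z₂) − d(p, q)| ≤ d(p, z₁) + d(q, z₂)`. [folklore] -/
theorem abs_dist_sub_dist_le (z₁ z₂ p q : M) :
    |dist z₁ z₂ - dist p q| ≤ dist p z₁ + dist q z₂ := by
  have h2 := abs_dist_sub_le z₁ p z₂
  have h3 := abs_dist_sub_le z₂ q p
  rw [dist_comm z₂ p, dist_comm q p] at h3
  have h4 := abs_sub_le (dist z₁ z₂) (dist p z₂) (dist p q)
  rw [dist_comm z₁ p] at h2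
  rw [dist_comm z₂ q] at h3
  linarith

variable [CompactSpace M]

/-- **Colding's frame extension, synthetic core** ("project away the largest component"): see the
module docstring. With `k = card ι`, the smallness conditions are `k r² < γ`, `η + r < 1`,
`3(η + 2r) ≤ γ₁/2` and `3k(α + η + 2r + β) + 3(η + 2r) < γγ₁/k`. [cite: Colding1996Shape, §2] -/
theorem exists_sum_cos_dist_sq_le (hdiam : ∀ y z : M, dist y z ≤ Real.pi)
    {ι : Type*} [Fintype ι] [Nonempty ι] (x : ι → M)
    {γ γ₁ α β r η : ℝ} (hγ : 0 < γ) (hγ₁ : 0 < γ₁) (hγ₁1 : γ₁ ≤ 1)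
    (hα : 0 ≤ α) (hβ : 0 ≤ β) (hr : 0 ≤ r) (hη : 0 ≤ η)
    (hr2 : Fintype.card ι * r ^ 2 < γ) (hηr : η + r < 1)
    (hε₂ : 3 * (η + 2 * r) ≤ γ₁ / 2)
    (hε : 3 * Fintype.card ι * (α + η + 2 * r + β) + 3 * (η + 2 * r) < γ * γ₁ / Fintype.card ι)
    (hz₀ : ∃ z₀ : M, ∑ i, Real.cos (dist (x i) z₀) ^ 2 ≤ 1 - γ₁)
    (hframe : ∀ i i', i ≠ i' → |Real.cos (dist (x i) (x i'))| ≤ α)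
    (hanti : ∀ i, ∃ xb : M, ∀ w, |Real.cos (dist (x i) w) + Real.cos (dist xb w)| ≤ η)
    (hgood : ∀ y₁ y₂ : M, ∃ (z₁ z₂ : M) (p : ℝ → M), dist y₁ z₁ ≤ r ∧ dist y₂ z₂ ≤ r ∧
      Continuous p ∧ p 0 = z₁ ∧ p 1 = z₂ ∧
      ∀ i, ∀ s ∈ Icc (0:ℝ) 1,
        |Real.sin (dist z₁ z₂) * Real.cos (dist (x i) (p s)) -
          (Real.sin ((1 - s) * dist z₁ z₂) * Real.cos (dist (x i) z₁) +
            Real.sin (s * dist z₁ z₂) * Real.cos (dist (x i) z₂))| ≤ β) :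
    ∃ z : M, ∑ i, Real.cos (dist (x i) z) ^ 2 ≤ γ := by
  classical
  haveI : Nonempty M := ⟨x (Classical.arbitrary ι)⟩
  have hk0 : 0 < (Fintype.card ι : ℝ) := by exact_mod_cast Fintype.card_pos
  have hk1 : (1 : ℝ) ≤ Fintype.card ι := by exact_mod_cast Fintype.card_pos
  -- `F` and a minimiser
  have hFc : Continuous fun w : M ↦ ∑ i, Real.cos (dist (x i) w) ^ 2 := by
    refine continuous_finsetSum _ fun i _ ↦ ?_
    exact (Real.continuous_cos.comp (continuous_const.dist continuous_id)).pow 2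
  obtain ⟨zs, -, hmin⟩ := isCompact_univ.exists_isMinOn univ_nonempty hFc.continuousOn
  have hmin' : ∀ w, ∑ i, Real.cos (dist (x i) zs) ^ 2 ≤ ∑ i, Real.cos (dist (x i) w) ^ 2 :=
    fun w ↦ hmin (mem_univ w)
  obtain ⟨z₀, hz₀⟩ := hz₀
  refine ⟨zs, ?_⟩
  by_contra hcon
  push Not at hcon
  -- abbreviations
  set Fz : ℝ := ∑ i, Real.cos (dist (x i) zs) ^ 2 with hFz
  have hFz1 : Fz ≤ 1 - γ₁ := (hmin' z₀).trans hz₀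
  have hFz0 : 0 ≤ Fz := Finset.sum_nonneg fun i _ ↦ sq_nonneg _
  -- the largest component
  obtain ⟨i, -, hi⟩ := Finset.exists_max_image Finset.univ (fun i ↦ Real.cos (dist (x i) zs) ^ 2)
    Finset.univ_nonempty
  set c : ℝ := Real.cos (dist (x i) zs) with hc
  set a : ℝ := c ^ 2 with ha
  have ha0 : 0 ≤ a := sq_nonneg _
  have haF : Fz ≤ Fintype.card ι * a := by
    have h1 := Finset.sum_le_card_nsmul Finset.univ (fun i' ↦ Real.cos (dist (x i') zs) ^ 2) a
      fun i' _ ↦ hi i' (Finset.mem_univ _)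
    rwa [Finset.card_univ, nsmul_eq_mul] at h1
  have haγ : γ / Fintype.card ι < a := by rw [div_lt_iff₀ hk0]; linarith only [hcon, haF]
  have hc1 : |c| ≤ 1 := Real.abs_cos_le_one _
  have ha1 : a ≤ 1 := by rw [ha, ← sq_abs]; nlinarith only [hc1, abs_nonneg c]
  have haFz : a ≤ Fz :=
    Finset.single_le_sum (fun i' _ ↦ sq_nonneg (Real.cos (dist (x i') zs))) (Finset.mem_univ i)
  have hapos : 0 < a := lt_trans (div_pos hγ hk0) haγ
  have hca : |c| ^ 2 = a := sq_abs c
  have hcpos : 0 < |c| := by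
    rcases (abs_nonneg c).lt_or_eq with h1 | h1
    · exact h1
    · rw [← h1] at hca; simp at hca; linarith
  have hr_lt : r < |c| := by
    have h1 : r ^ 2 < a := by
      have h2 : (Fintype.card ι : ℝ) * r ^ 2 < Fintype.card ι * a :=
        lt_of_lt_of_le hr2 (hcon.le.trans haF)
      exact lt_of_mul_lt_mul_left h2 hk0.le
    rw [← hca] at h1
    exact lt_of_pow_lt_pow_left₀ 2 (abs_nonneg c) h1
  -- `ε₁ = α + η + 2r + β ≤ 1/3`
  set ε₁ : ℝ := α + η + 2 * r + β with hε₁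
  have hε₁0 : 0 ≤ ε₁ := by positivity
  have hγk : γ * γ₁ / Fintype.card ι ≤ 1 := by
    rw [div_le_one hk0]
    have h1 : γ ≤ Fintype.card ι * a := hcon.le.trans haF
    nlinarith only [h1, ha1, hγ₁1, hγ₁.le, hγ.le, hk0.le]
  have hε₁1 : ε₁ ≤ 1 := by
    have h1 : 3 * ε₁ ≤ 3 * Fintype.card ι * ε₁ := by nlinarith only [hk1, hε₁0]
    have h2 : 0 ≤ 3 * (η + 2 * r) := by positivity
    have h3 : ε₁ = α + η + 2 * r + β := rfl
    linarith only [h1, h2, hε, hγk, h3]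
  -- the source point `p₀`
  obtain ⟨xb, hxb⟩ := hanti i
  set σ : ℝ := if c < 0 then -1 else 1 with hσ
  have hσc : σ * c = |c| := by
    rcases lt_or_ge c 0 with h1 | h1
    · rw [hσ, if_pos h1, abs_of_neg h1]; ring
    · rw [hσ, if_neg (not_lt.2 h1), abs_of_nonneg h1]; ring
  have hσ1 : |σ| = 1 := by
    rcases lt_or_ge c 0 with h1 | h1
    · rw [hσ, if_pos h1]; simp
    · rw [hσ, if_neg (not_lt.2 h1)]; simp
  obtain ⟨p₀, hp1, hp2, hp3⟩ : ∃ p₀ : M, (∀ i', i' ≠ i → |Real.cos (dist (x i') p₀)| ≤ α + η) ∧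
      |Real.cos (dist p₀ zs)| ≤ |c| + η ∧ σ * Real.cos (dist (x i) p₀) ≤ -(1 - η) := by
    rcases lt_or_ge c 0 with h1 | h1
    · refine ⟨x i, fun i' hi' ↦ ?_, ?_, ?_⟩
      · have h2 := hframe i' i hi'
        linarith only [h2, hη]
      · have e : Real.cos (dist (x i) zs) = c := rfl
        rw [e]; linarith only [hη]
      · rw [hσ, if_pos h1, dist_self, Real.cos_zero]; linarith only [hη]
    · refine ⟨xb, fun i' hi' ↦ ?_, ?_, ?_⟩
      · have h2 := hxb (x i')
        have h3 := hframe i i' (Ne.symm hi')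
        rw [dist_comm (x i') xb]
        have h4 := abs_add_le (-Real.cos (dist (x i) (x i')))
          (Real.cos (dist (x i) (x i')) + Real.cos (dist xb (x i')))
        rw [abs_neg, neg_add_cancel_left] at h4
        linarith only [h2, h3, h4]
      · have h2 := hxb zs
        have h4 := abs_add_le (-Real.cos (dist (x i) zs))
          (Real.cos (dist (x i) zs) + Real.cos (dist xb zs))
        rw [abs_neg, neg_add_cancel_left] at h4
        have h5 : |c + Real.cos (dist xb zs)| ≤ η := by rw [hc]; exact h2
        have h6 : |Real.cos (dist xb zs)| ≤ |c| + |c + Real.cos (dist xb zs)| := by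
          rw [hc]; exact h4
        linarith only [h5, h6]
      · have h2 := hxb xb
        rw [dist_self, Real.cos_zero] at h2
        rw [hσ, if_neg (not_lt.2 h1), one_mul]
        have h3 := (abs_le.1 h2).2
        linarith only [h3]
  -- the good path near `(p₀, zs)`
  obtain ⟨z₁, z₂, p, hz₁, hz₂, hpc, hp0, hp1', hlaw⟩ := hgood p₀ zs
  set ℓ : ℝ := dist z₁ z₂ with hℓ
  have hℓ0 : 0 ≤ ℓ := dist_nonneg
  have hℓπ : ℓ ≤ Real.pi := hdiam z₁ z₂
  -- `sin² ℓ ≥ 1 − a − 3(η + 2r)`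
  have hcosℓ : |Real.cos ℓ| ≤ |c| + (η + 2 * r) := by
    have h1 : |ℓ - dist p₀ zs| ≤ 2 * r := by
      have h2 := abs_dist_sub_dist_le z₁ z₂ p₀ zs
      have h3 : dist zs z₂ ≤ r := hz₂
      have h4 : dist p₀ z₁ ≤ r := hz₁
      have h5 : ℓ = dist z₁ z₂ := rfl
      linarith only [h2, h3, h4, h5]
    have h2 := Real.abs_cos_sub_cos_le ℓ (dist p₀ zs)
    have h3 := abs_sub_abs_le_abs_sub (Real.cos ℓ) (Real.cos (dist p₀ zs))
    linarith only [h1, h2, h3, hp2]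
  have hsin2 : 1 - a - 3 * (η + 2 * r) ≤ Real.sin ℓ ^ 2 := by
    rw [Real.sin_sq]
    have h2 : 0 ≤ η + 2 * r := by positivity
    have h3 : η + 2 * r ≤ 1 := by linarith only [hηr, hr, hε₂, hγ₁1]
    have h5 : Real.cos ℓ ^ 2 ≤ (|c| + (η + 2 * r)) ^ 2 := by
      rw [← sq_abs (Real.cos ℓ)]
      exact pow_le_pow_left₀ (abs_nonneg _) hcosℓ 2
    have h6 : (|c| + (η + 2 * r)) ^ 2 ≤ a + 3 * (η + 2 * r) := by
      nlinarith only [hc1, h2, h3, hca, abs_nonneg c]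
    linarith only [h5, h6]
  have hsinpos : 0 < Real.sin ℓ := by
    have h1 : 0 < Real.sin ℓ ^ 2 := by
      refine lt_of_lt_of_le ?_ hsin2
      linarith only [haFz, hFz1, hε₂, hγ₁]
    have h2 : 0 ≤ Real.sin ℓ := Real.sin_nonneg_of_nonneg_of_le_pi hℓ0 hℓπ
    rcases h2.lt_or_eq with h3 | h3
    · exact h3
    · rw [← h3] at h1; simp at h1
  -- IVT: `u_i` vanishes at some `q = p s*`
  have hfc : Continuous fun s : ℝ ↦ σ * Real.cos (dist (x i) (p s)) :=
    continuous_const.mul (Real.continuous_cos.comp (continuous_const.dist hpc))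
  have hf0 : σ * Real.cos (dist (x i) (p 0)) < 0 := by
    rw [hp0]
    have h1 : |Real.cos (dist (x i) z₁) - Real.cos (dist (x i) p₀)| ≤ r :=
      (abs_cos_dist_sub_cos_dist_le (x i) z₁ p₀).trans (by rwa [dist_comm])
    have h3 : |σ * (Real.cos (dist (x i) z₁) - Real.cos (dist (x i) p₀))| ≤ r := by
      rw [abs_mul, hσ1, one_mul]; exact h1
    have h4 := (abs_le.1 h3).2
    linarith only [hp3, h4, hηr]
  have hf1 : 0 < σ * Real.cos (dist (x i) (p 1)) := by
    rw [hp1']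
    have h1 : |Real.cos (dist (x i) z₂) - c| ≤ r := by
      rw [hc]; exact (abs_cos_dist_sub_cos_dist_le (x i) z₂ zs).trans (by rwa [dist_comm])
    have h3 : |σ * (Real.cos (dist (x i) z₂) - c)| ≤ r := by
      rw [abs_mul, hσ1, one_mul]; exact h1
    have h4 := (abs_le.1 h3).1
    linarith only [h4, hσc, hr_lt]
  obtain ⟨sstar, hsstar, hzero⟩ : ∃ s ∈ Icc (0:ℝ) 1, σ * Real.cos (dist (x i) (p s)) = 0 :=
    intermediate_value_Icc zero_le_one hfc.continuousOn ⟨hf0.le, hf1.le⟩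
  set q : M := p sstar with hq
  have hσ0 : σ ≠ 0 := by
    intro h0; rw [h0, abs_zero] at hσ1; exact zero_ne_one hσ1
  have huq : Real.cos (dist (x i) q) = 0 := by
    rcases mul_eq_zero.1 hzero with h1 | h1
    · exact absurd h1 hσ0
    · exact h1
  -- the other components at `q`
  have hcomp : ∀ i', i' ≠ i →
      Real.sin ℓ * |Real.cos (dist (x i') q)| ≤ |Real.cos (dist (x i') zs)| + ε₁ := by
    intro i' hi'
    have h1 := hlaw i' sstar hsstar
    have hz₁' : |Real.cos (dist (x i') z₁)| ≤ α + η + r := by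
      have h2 : |Real.cos (dist (x i') z₁) - Real.cos (dist (x i') p₀)| ≤ r :=
        (abs_cos_dist_sub_cos_dist_le (x i') z₁ p₀).trans (by rwa [dist_comm])
      have h3 := hp1 i' hi'
      have := abs_sub_abs_le_abs_sub (Real.cos (dist (x i') z₁)) (Real.cos (dist (x i') p₀))
      linarith
    have hz₂' : |Real.cos (dist (x i') z₂)| ≤ |Real.cos (dist (x i') zs)| + r := by
      have h2 : |Real.cos (dist (x i') z₂) - Real.cos (dist (x i') zs)| ≤ r :=
        (abs_cos_dist_sub_cos_dist_le (x i') z₂ zs).trans (by rwa [dist_comm])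
      have := abs_sub_abs_le_abs_sub (Real.cos (dist (x i') z₂)) (Real.cos (dist (x i') zs))
      linarith
    have h4 : |Real.sin ℓ * Real.cos (dist (x i') q)| ≤
        |Real.sin ((1 - sstar) * ℓ) * Real.cos (dist (x i') z₁) +
          Real.sin (sstar * ℓ) * Real.cos (dist (x i') z₂)| + β := by
      have := abs_sub_abs_le_abs_sub (Real.sin ℓ * Real.cos (dist (x i') q))
        (Real.sin ((1 - sstar) * ℓ) * Real.cos (dist (x i') z₁) +
          Real.sin (sstar * ℓ) * Real.cos (dist (x i') z₂))
      linarith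
    have h5 : |Real.sin ((1 - sstar) * ℓ) * Real.cos (dist (x i') z₁) +
        Real.sin (sstar * ℓ) * Real.cos (dist (x i') z₂)| ≤
        |Real.cos (dist (x i') z₁)| + |Real.cos (dist (x i') z₂)| := by
      refine (abs_add_le _ _).trans ?_
      rw [abs_mul, abs_mul]
      have i1 := mul_le_mul (Real.abs_sin_le_one ((1 - sstar) * ℓ)) le_rfl
        (abs_nonneg (Real.cos (dist (x i') z₁))) zero_le_one
      have i2 := mul_le_mul (Real.abs_sin_le_one (sstar * ℓ)) le_rfl
        (abs_nonneg (Real.cos (dist (x i') z₂))) zero_le_one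
      linarith
    rw [abs_mul, abs_of_pos hsinpos] at h4
    have h6 : ε₁ = α + η + 2 * r + β := rfl
    linarith only [h4, h5, hz₁', hz₂', h6]
  -- termwise bound and summation
  set S : ℝ := Real.sin ℓ ^ 2 with hS
  have hS0 : 0 < S := pow_pos hsinpos 2
  have hterm : ∀ i', Real.cos (dist (x i') q) ^ 2 + (if i' = i then a else 0) / S ≤
      (Real.cos (dist (x i') zs) ^ 2 + 3 * ε₁) / S := by
    intro i'
    by_cases hi' : i' = i
    · subst hi'
      rw [if_pos rfl, huq]
      simp only [ne_eq, OfNat.ofNat_ne_zero, not_false_eq_true, zero_pow, zero_add]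
      exact div_le_div_of_nonneg_right (by linarith only [hε₁0, ha.le, ha.ge]) hS0.le
    · rw [if_neg hi', zero_div, add_zero, le_div_iff₀ hS0]
      have h1 := hcomp i' hi'
      have h2 : (Real.sin ℓ * |Real.cos (dist (x i') q)|) ^ 2 ≤
          (|Real.cos (dist (x i') zs)| + ε₁) ^ 2 :=
        pow_le_pow_left₀ (mul_nonneg hsinpos.le (abs_nonneg _)) h1 2
      have h3 : (|Real.cos (dist (x i') zs)| + ε₁) ^ 2 ≤ Real.cos (dist (x i') zs) ^ 2 + 3 * ε₁ := by
        have h4 := Real.abs_cos_le_one (dist (x i') zs)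
        have h5 : |Real.cos (dist (x i') zs)| ^ 2 = Real.cos (dist (x i') zs) ^ 2 := sq_abs _
        nlinarith only [h4, h5, hε₁0, hε₁1, abs_nonneg (Real.cos (dist (x i') zs))]
      calc Real.cos (dist (x i') q) ^ 2 * S = (Real.sin ℓ * |Real.cos (dist (x i') q)|) ^ 2 := by
            rw [hS, mul_pow, sq_abs]; ring
        _ ≤ Real.cos (dist (x i') zs) ^ 2 + 3 * ε₁ := h2.trans h3
  have hsum : ∑ i', Real.cos (dist (x i') q) ^ 2 + a / S ≤
      (Fz + 3 * Fintype.card ι * ε₁) / S := by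
    have h1 := Finset.sum_le_sum fun i' (_ : i' ∈ Finset.univ) ↦ hterm i'
    rw [Finset.sum_add_distrib, ← Finset.sum_div, Finset.sum_ite_eq' Finset.univ i,
      if_pos (Finset.mem_univ i), ← Finset.sum_div, Finset.sum_add_distrib, Finset.sum_const,
      Finset.card_univ, nsmul_eq_mul] at h1
    have h2 : (∑ i', Real.cos (dist (x i') zs) ^ 2 + (Fintype.card ι : ℝ) * (3 * ε₁)) / S =
        (Fz + 3 * Fintype.card ι * ε₁) / S := by
      rw [hFz]; ring
    rw [h2] at h1
    exact h1
  -- contradiction with minimality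
  have hFq : Fz ≤ ∑ i', Real.cos (dist (x i') q) ^ 2 := hmin' q
  have h1 : Fz * S + a ≤ Fz + 3 * Fintype.card ι * ε₁ := by
    have h3 : (∑ i', Real.cos (dist (x i') q) ^ 2 + a / S) * S ≤
        (Fz + 3 * Fintype.card ι * ε₁) / S * S := mul_le_mul_of_nonneg_right hsum hS0.le
    rw [add_mul, div_mul_cancel₀ _ hS0.ne', div_mul_cancel₀ _ hS0.ne'] at h3
    have h4 : Fz * S ≤ (∑ i', Real.cos (dist (x i') q) ^ 2) * S :=
      mul_le_mul_of_nonneg_right hFq hS0.le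
    linarith only [h3, h4]
  have h2 : a * (1 - Fz) ≤ 3 * Fintype.card ι * ε₁ + 3 * (η + 2 * r) * Fz := by
    have h5 : Fz * (1 - S) ≤ Fz * (a + 3 * (η + 2 * r)) :=
      mul_le_mul_of_nonneg_left (by linarith only [hsin2]) hFz0
    linarith only [h1, h5]
  have h3 : γ * γ₁ / Fintype.card ι < a * (1 - Fz) := by
    have h4 : γ₁ ≤ 1 - Fz := by linarith only [hFz1]
    have h6 : γ * γ₁ / Fintype.card ι = γ / Fintype.card ι * γ₁ := by ring
    rw [h6]
    calc γ / Fintype.card ι * γ₁ < a * γ₁ := mul_lt_mul_of_pos_right haγ hγ₁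
      _ ≤ a * (1 - Fz) := mul_le_mul_of_nonneg_left h4 ha0
  have h7 : 3 * (η + 2 * r) * Fz ≤ 3 * (η + 2 * r) := by
    have h8 : Fz ≤ 1 := by linarith only [hFz1, hγ₁]
    have h9 : 0 ≤ 3 * (η + 2 * r) := by positivity
    nlinarith only [h8, h9]
  have hε' : 3 * Fintype.card ι * ε₁ + 3 * (η + 2 * r) < γ * γ₁ / Fintype.card ι := hε
  linarith only [h2, h3, h7, hε']

end ColdingSynthetic

end Literature.Geometry.Riemannian

end
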